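import Summits.AtomisticToContinuum.HydrodynamicLimit.Theorems.OneFlightGossipEngineEquilibriumClampedCollisionalWindowLDDefs

/-!
# Vocabulary of the line `radial-virial-polarization` for the crux `EquilibriumClampedCollisionalWindowLD`
(stmt-AtomisticToContinuum-13733; TwoClocks rank 3 / OneFlightGossipEngine rank 5 — byte-identical route decls)

Definitions-only support file (`--supports stmt-AtomisticToContinuum-13733`) of the line lead c2-0
(`Cruxes/EquilibriumClampedCollisionalWindowLD/Lines/radial_virial_polarization.lean`; skeleton registered on the item with the
seven stubs `stub_isotropicUpperTail`, `stub_isotropicLowerTail`, `stub_tracelessVirialLD`, `stub_thermalTransferLD` (open LD cores),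
`stub_collisionDecomposition` (landed p110978), `stub_measurability` (p107227), `stub_orbitIntegrable` (p107056)). It extends the
shared vocabulary `…WindowLDDefs` (`ClampedTransferCoin`: `Flow`, `Phase`, `Rec`, `gibbs`, `window`, `flagG`, `Xrow`, `Arow`, …) by the
objects of the radial-virial line, so that the line's composition (`…RadialVirialTemplate/Algebra/EOS/Assembly`) lands against one
importable vocabulary:

* `Rvir` — the CLAMPED RADIAL VIRIAL `Σ_records ω_fst ω_snd Γ(c) ‖Δv_fst‖ / 2` with a record weight `Γ` (window-global transfer clamp
  `flagG`), `virN = w⁻¹ ε_N Rvir`; the angular weights `quadWeight S = ⟨ω̂, S(x_fst) ω̂⟩`, `thermalWeight u₀ b = ⟨ω̂,b(x_fst)⟩⟨V_cm − u₀,ω̂⟩`;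
* the EOS projections `isoProjection` (`3∫₀^w Σψ(x_i)(θ₀σ³Z′ + ⅓(Z−1)|v_i−u₀|²) − 3w(N+1)θ₀σ³Z′∫ψ`), `thermalProjection`
  (`∫₀^w θ₀(Z−1)ΣΣ b_l(x_i)(v_i−u₀)_l`), and the centred functionals `isoFluct`, `tracelessFluct`, `thermalFluct`;
* the weights attached to a test function `φ`: `gamM`, `gamE` (the radial-virial weights of the momentum / energy rows delivered by
  `stub_collisionDecomposition`), their isotropic parts `psiM = ⅓∂_kφ`, `psiE = ⅓⟨∇φ,u₀⟩`, traceless parts `devM`, `devE`, and `gradF`;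
* (NOT here: the four window-LD statements S1–S4 of the line — `IsotropicUpperTail`, `IsotropicLowerTail`, `TracelessVirialLD`,
  `ThermalTransferLD` — stay in the skeleton as registered stub statements; the conditional composition
  `clampedTransferWindowLD_of_LD` of `…RadialVirialAssembly` takes them as hypotheses written with the LD template.)

Sources: Chapman–Cowling 1970 §16.4 (collisional transfer), Spohn 1991 Part I (3.7)–(3.15) (collisional stress / virial), the crux-plan
card `Ideas/radial-virial-polarization.md` (triage TRIAGE-r1-1/2/3). prover-line-stmt-AtomisticToContinuum-13733-c2-0, 2026-08-16.
-/

noncomputable section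

open MeasureTheory Set Filter
open scoped ENNReal BigOperators
open Literature.Analysis.FluidPDE Literature.MathematicalPhysics.KineticTheory
open Literature.Analysis.FunctionSpaces (Torus.partialDeriv Torus.IsSmooth)

namespace Summit.AtomisticToContinuum.HydrodynamicLimit.Theorems.ClampedTransferCoin

namespace RadialVirial

/-! ## § 1 Vocabulary of the line: clamped radial virials, weights, EOS projections -/

/-- The CLAMPED RADIAL VIRIAL with record weight `Γ` over the window (window-global transfer clamp `flagG` on both
partners, ordered records × ½): `R_Γ(z) = Σ_records ω_fst ω_snd Γ(c) ‖v_fst⁺ − v_fst⁻‖ / 2`. -/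
def Rvir (σ τ V : ℝ) {N : ℕ} (Φ : Flow σ N) (Γ : Rec N → ℝ) (z : Phase N) : ℝ :=
  Φ.collisionSum (Set.Ioc 0 (window τ N))
    (fun c => flagG σ τ V Φ c.fst z * flagG σ τ V Φ c.snd z * (Γ c * ‖c.postVel.1 - c.preVel.1‖) / 2) z

/-- The quadratic-form angular weight `⟨ω̂, S(x_fst) ω̂⟩` of a matrix field `S`. -/
def quadWeight {N : ℕ} (S : T3 → Fin 3 → Fin 3 → ℝ) (c : Rec N) : ℝ :=
  ∑ a, ∑ b, c.impactVec a * S c.fstPos a b * c.impactVec b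

/-- The thermal energy-transfer weight `⟨ω̂, b(x_fst)⟩ ⟨V_cm − u₀, ω̂⟩`, `V_cm = ½(v_fst⁺ + v_snd⁺)`, for a family of three
scalar fields `b` (the composition uses `b l = ∂_l φ`). -/
def thermalWeight {N : ℕ} (u₀ : V3) (b : Fin 3 → T3 → ℝ) (c : Rec N) : ℝ :=
  (∑ l, b l c.fstPos * c.impactVec l) *
    (∑ l, (((2 : ℝ)⁻¹ • (c.postVel.1 + c.postVel.2)) l - u₀ l) * c.impactVec l)

/-- The window-normalised clamped radial virial `w⁻¹ ε_N R_Γ`. -/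
def virN (σ τ V : ℝ) {N : ℕ} (Φ : Flow σ N) (Γ : Rec N → ℝ) (z : Phase N) : ℝ :=
  (window τ N)⁻¹ * (hsDiameter σ N * Rvir σ τ V Φ Γ z)

/-- EOS projection of an isotropic weight `ψ` (linear static response of the local collisional virial `3 p_c`,
`p_c = ρθ(Z(ρσ³) − 1)`, to density and kinetic energy, constant term included):
`A_ψ = 3 ∫₀^w Σ_i ψ(x_i)(θ₀σ³Z′ + ⅓(Z−1)|v_i − u₀|²) dr − 3 w (N+1) θ₀σ³Z′ ∫_{𝕋³} ψ`. -/
def isoProjection (σ θ₀ : ℝ) (u₀ : V3) (τ : ℝ) {N : ℕ} (Φ : Flow σ N) (ψ : T3 → ℝ) (z : Phase N) : ℝ :=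
  3 * (∫ r in (0 : ℝ)..window τ N, ∑ i, ψ (Φ.flow r z i).1 *
      (θ₀ * σ ^ 3 * deriv hsCompressibility (σ ^ 3) +
        (1 / 3) * (hsCompressibility (σ ^ 3) - 1) * ‖(Φ.flow r z i).2 - u₀‖ ^ 2)) -
    3 * (window τ N * ((((N : ℝ) + 1) * (θ₀ * σ ^ 3 * deriv hsCompressibility (σ ^ 3))) * ∫ x, ψ x))

/-- EOS projection of the thermal transfer with weights `b` (linear response `p_c δu`, pressure work):
`A_b = ∫₀^w θ₀ (Z−1) Σ_i Σ_l b_l(x_i) (v_i − u₀)_l dr`. -/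
def thermalProjection (σ θ₀ : ℝ) (u₀ : V3) (τ : ℝ) {N : ℕ} (Φ : Flow σ N) (b : Fin 3 → T3 → ℝ) (z : Phase N) : ℝ :=
  ∫ r in (0 : ℝ)..window τ N, θ₀ * (hsCompressibility (σ ^ 3) - 1) *
    ∑ i, ∑ l, b l (Φ.flow r z i).1 * ((Φ.flow r z i).2 - u₀) l

/-- The centred ISOTROPIC functional `Y_ψ = w⁻¹ ε_N R_{ψ∘fstPos} − w⁻¹ A_ψ`. -/
def isoFluct (σ θ₀ : ℝ) (u₀ : V3) (τ V : ℝ) {N : ℕ} (Φ : Flow σ N) (ψ : T3 → ℝ) (z : Phase N) : ℝ :=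
  virN σ τ V Φ (fun c => ψ c.fstPos) z - (window τ N)⁻¹ * isoProjection σ θ₀ u₀ τ Φ ψ z

/-- The TRACELESS functional `T_S = w⁻¹ ε_N R_{⟨ω̂,Sω̂⟩}` (zero centring). -/
def tracelessFluct (σ τ V : ℝ) {N : ℕ} (Φ : Flow σ N) (S : T3 → Fin 3 → Fin 3 → ℝ) (z : Phase N) : ℝ :=
  virN σ τ V Φ (quadWeight S) z

/-- The centred THERMAL transfer functional `Θ_b = w⁻¹ ε_N R_{thermal b} − w⁻¹ A_b`. -/
def thermalFluct (σ θ₀ : ℝ) (u₀ : V3) (τ V : ℝ) {N : ℕ} (Φ : Flow σ N) (b : Fin 3 → T3 → ℝ) (z : Phase N) : ℝ :=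
  virN σ τ V Φ (thermalWeight u₀ b) z - (window τ N)⁻¹ * thermalProjection σ θ₀ u₀ τ Φ b z

/-! ### The weights attached to a test function `φ` -/

/-- The symmetrised outer product `Sym(g ⊗ e)`. -/
def symOuter (g e : Fin 3 → ℝ) (a b : Fin 3) : ℝ := (g a * e b + e a * g b) / 2

/-- S5's momentum-row weight `Γ_k = ⟨∇φ(x_fst), ω̂⟩ ω̂_k`. -/
def gamM {N : ℕ} (φ : T3 → ℝ) (k : Fin 3) (c : Rec N) : ℝ :=
  (∑ l, Torus.partialDeriv l φ c.fstPos * c.impactVec l) * c.impactVec k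

/-- S5's energy-row weight `Γ_e = ⟨∇φ(x_fst), ω̂⟩ ⟨V_cm, ω̂⟩`. -/
def gamE {N : ℕ} (φ : T3 → ℝ) (c : Rec N) : ℝ :=
  (∑ l, Torus.partialDeriv l φ c.fstPos * c.impactVec l) *
    (∑ l, ((2 : ℝ)⁻¹ • (c.postVel.1 + c.postVel.2)) l * c.impactVec l)

/-- Isotropic weight of momentum row `k`: `ψ_k = ⅓ ∂_kφ`. -/
def psiM (φ : T3 → ℝ) (k : Fin 3) (x : T3) : ℝ := 3⁻¹ * Torus.partialDeriv k φ x

/-- Isotropic weight of the energy row: `ψ_e = ⅓ ⟨∇φ, u₀⟩`. -/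
def psiE (u₀ : V3) (φ : T3 → ℝ) (x : T3) : ℝ := 3⁻¹ * ∑ l, Torus.partialDeriv l φ x * u₀ l

/-- Traceless matrix weight of momentum row `k`: `S°_k = Sym(∇φ ⊗ e_k) − ψ_k I`. -/
def devM (φ : T3 → ℝ) (k : Fin 3) (x : T3) (a b : Fin 3) : ℝ :=
  symOuter (fun l => Torus.partialDeriv l φ x) (Pi.single k 1) a b - if a = b then psiM φ k x else 0

/-- Traceless matrix weight of the energy row: `S°_e = Sym(∇φ ⊗ u₀) − ψ_e I`. -/
def devE (u₀ : V3) (φ : T3 → ℝ) (x : T3) (a b : Fin 3) : ℝ :=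
  symOuter (fun l => Torus.partialDeriv l φ x) (fun l => u₀ l) a b - if a = b then psiE u₀ φ x else 0

/-- The gradient as a family of three scalar fields (thermal weight `b = ∇φ`). -/
def gradF (φ : T3 → ℝ) (l : Fin 3) (x : T3) : ℝ := Torus.partialDeriv l φ x

/-- Families of hard-sphere flows at reduced diameter `σ` (the crux's `Φ`). -/
abbrev Flows (σ : ℝ) : Type := (N : ℕ) → Flow σ N

/-- Unfolding lemma (the registered anchor of this vocabulary file): `virN = w⁻¹ ε_N Rvir`. -/
theorem radialVirialDefs_virN_eq (σ τ V : ℝ) {N : ℕ} (Φ : Flow σ N) (Γ : Rec N → ℝ) (z : Phase N) : virN σ τ V Φ Γ z = (window τ N)⁻¹ * (hsDiameter σ N * Rvir σ τ V Φ Γ z) :=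
  rfl

end RadialVirial

end Summit.AtomisticToContinuum.HydrodynamicLimit.Theorems.ClampedTransferCoin

end
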